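import Summits.BirchSwinnertonDyer.BirchSwinnertonDyer.Theorems.ManinLocalTwoThreeShiftInvariantHeckeEigenvalue
import Summits.BirchSwinnertonDyer.BirchSwinnertonDyer.Theorems.ManinLocalTwoThreeCongruenceHomShiftInvariant
import Literature.NumberTheory.EllipticCurves.ModPReducibility
import Literature.NumberTheory.EllipticCurves.LFunctionPrimeCoeff
import HarnessLib

/-!
# The Eisenstein end of E-es-25: a congruence cocycle in a non-Eisenstein generalised eigenspace vanishes

Summit `BirchSwinnertonDyer`, cruxes C3 `ManinPrimeToThreeAtNine` (stmt-BirchSwinnertonDyer-22968) / C2 `ManinOddAtFour`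
(stmt-22967), route `ManinLocalTwoThree` (cell bsd-f2-manin); E-es-25 (relative Ihara at a prime dividing the level,
MEMO-es §21.2) steps (1) and (5) both end in the same way: a degree-`0` cocycle `u : Γ₀(N) → K` (char `K = p`) that
(i) kills a principal congruence subgroup `Γ(M)` (from the congruence subgroup property of `SL₂(ℤ[1/t])`, tree theorem
`SerreSL2Congruence1970_congruenceSubgroupProperty_away_holds`, or from a finite quotient in the Hochschild–Serre edge) and
(ii) lies in the generalised eigenspace `[𝔪_W^∞]` of the Hecke eigensystem `ℓ ↦ a_ℓ(W)` of an elliptic curve `W` with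
`W[p]` IRREDUCIBLE, must vanish.  This file proves exactly that (`eq_zero_of_killsCongruence_of_isHeckeGenEigenvector`),
from the two sibling files (`shiftInvariant_of_congruence`: (i) ⟹ `π_ℓ^* u = π_1^* u` for `ℓ ∤ M`;
`heckeU_eq_smul_of_shiftInvariant`: ⟹ `T_ℓ u = (ℓ+1) u`), elementary linear algebra
(`eq_of_apply_eq_smul_of_mem_maxGenEigenspace`: an honest eigenvector inside a generalised eigenspace pins the
eigenvalue), the tree dictionary `WeierstrassCurve.LFunction_apply_prime_eq_frobeniusTrace`, and ONE printed input taken as a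
hypothesis: Darmon–Diamond–Taylor Prop. 2.6(b) with an ARBITRARY finite exceptional set `S` (the tree's
`not_irreducible_of_frobeniusTrace_congr` is its instance `S = {p} ∪ {bad primes}`; here the primes of `M` — not
controlled by the congruence subgroup property — must also be excepted; the general form is proposed to
`Literature/NumberTheory/EllipticCurves/ModPReducibility.lean` as `not_irreducible_of_frobeniusTrace_congr_off_finset`).

Coefficient condition `hR` («`M r = 0 ⟹ (x−1) r = 0` for `x` coprime to `M`»): automatic in characteristic `p ∤ M`
(`torsionCondition_of_not_dvd`), which is the case `(p,t) = (3,3)` / `(2,2)` of the lines (there `M` is prime to `t = p`).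
Nothing about BSD or Manin's conjecture is proved here.
-/

set_option autoImplicit false
set_option linter.dupNamespace false

open scoped MatrixGroups

open CongruenceSubgroup Literature.NumberTheory.EllipticCurves.ModularForms
  Literature.NumberTheory.EllipticCurves.ModularForms.HidaCohomology

namespace Summit.BirchSwinnertonDyer.BirchSwinnertonDyer.Theorems.ManinLocalTwoThree

section LinearAlgebra

variable {K V : Type*} [Field K] [AddCommGroup V] [Module K V]

/-- **An honest eigenvector inside a generalised eigenspace pins the eigenvalue**: if `T v = μ v`, `v ≠ 0` and
`v ∈ ⋃_k ker (T − λ)^k`, then `λ = μ` (since `(T − λ)^k v = (μ − λ)^k v`). [folklore] -/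
theorem eq_of_apply_eq_smul_of_mem_maxGenEigenspace (T : Module.End K V) {μ lam : K} {v : V} (hv : T v = μ • v)
    (hmem : v ∈ T.maxGenEigenspace lam) (hv0 : v ≠ 0) : lam = μ := by
  rw [Module.End.mem_maxGenEigenspace] at hmem
  obtain ⟨k, hk⟩ := hmem
  have hpow : ∀ j : ℕ, ((T - lam • (1 : Module.End K V)) ^ j) v = (μ - lam) ^ j • v := by
    intro j
    induction j with
    | zero => simp
    | succ j ih =>
      rw [pow_succ', Module.End.mul_apply, ih, map_smul, LinearMap.sub_apply, hv, LinearMap.smul_apply,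
        Module.End.one_apply, ← sub_smul, smul_smul, pow_succ', mul_comm]
  rw [hpow k] at hk
  rcases smul_eq_zero.mp hk with h | h
  · exact (sub_eq_zero.mp (pow_eq_zero_iff'.mp h).1).symm
  · exact absurd h hv0

end LinearAlgebra

section End

variable {N M : ℕ} {K : Type*} [Field K]

/-- In characteristic `p ∤ M`, `M r = 0` forces `r = 0`, so the coefficient condition of
`shiftInvariant_of_congruence` holds. [folklore] -/
theorem torsionCondition_of_not_dvd {p : ℕ} [Fact p.Prime] [CharP K p] (hpM : ¬ p ∣ M) (r : K)
    (hr : (M : ℤ) • r = 0) (x : ℤ) (_hx : IsCoprime x (M : ℤ)) : (x - 1) • r = 0 := by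
  have hM : (M : K) ≠ 0 := by
    intro h
    exact hpM ((CharP.cast_eq_zero_iff K p M).mp h)
  have : (M : K) * r = 0 := by
    rw [← Int.cast_natCast, ← zsmul_eq_mul]; exact hr
  rcases mul_eq_zero.mp this with h | h
  · exact absurd h hM
  · rw [h, smul_zero]

/-- **The Eisenstein end** (MEMO-es §21.2 (1)/(5)).  `K` a field of characteristic `p`, `W/ℚ` globally minimal with
`W[p]` irreducible; `u` a degree-`0` cocycle on `Γ₀(N)` which kills `Γ₀(N) ∩ Γ(M)` (`hKer`, entrywise congruence
to `1` mod `M`), whose coefficients satisfy the torsion condition for `M` (`hR`), and which is a generalised Hecke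
eigenvector for `ℓ ↦ a_ℓ(W)` away from a finite set `S` (`IsHeckeGenEigenvector`).  Then, GRANTED Darmon–Diamond–Taylor
Prop. 2.6(b) for `W`, `p` with an arbitrary finite exceptional set (hypothesis `hDDT`, spelled out; = the Literature named
fact `not_irreducible_of_frobeniusTrace_congr_off_finset` once it lands, cf. the tree's
`not_irreducible_of_frobeniusTrace_congr` = its instance `S = {p} ∪ bad`), `u = 0`.  Proof: for every prime
`ℓ ∉ S ∪ primes(N M p)` of good reduction, `u` is shift-invariant at `ℓ` (`shiftInvariant_of_congruence`), so
`T_ℓ u = (ℓ+1) u` (`heckeU_eq_smul_of_shiftInvariant`); if `u ≠ 0` this pins `a_ℓ(W) ≡ ℓ + 1 (mod p)` at all those `ℓ`,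
and the fact makes `W[p]` reducible. [folklore] -/
theorem eq_zero_of_killsCongruence_of_isHeckeGenEigenvector
    {p : ℕ} [Fact p.Prime] [CharP K p] (W : WeierstrassCurve ℚ) [W.IsElliptic] [W.IsGloballyMinimal]
    (hDDT : ∀ S : Finset ℕ, (∀ (ℓ : ℕ) [Fact ℓ.Prime], ℓ ∉ S → W.HasGoodReductionAtPrime ℓ →
        (p : ℤ) ∣ W.frobeniusTrace ℓ - (ℓ + 1)) → ¬ W.HasIrreducibleModPGaloisRep p)
    (hirr : W.HasIrreducibleModPGaloisRep p) [NeZero N] [NeZero M]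
    {u : Gamma0 N → Fin 1 → K} (hu : u ∈ cocycles 0 N K)
    (hKer : ∀ γ : Gamma0 N,
      (∀ i j, ((gmat γ i j : ℤ) : ZMod M) = (((1 : Matrix (Fin 2) (Fin 2) ℤ) i j : ℤ) : ZMod M)) → u γ = 0)
    (hR : ∀ r : K, (M : ℤ) • r = 0 → ∀ x : ℤ, IsCoprime x (M : ℤ) → (x - 1) • r = 0)
    (S : Finset ℕ) (heig : IsHeckeGenEigenvector S (fun ℓ ↦ ((W.LFunction ℓ : ℤ) : K)) ⟨u, hu⟩) :
    u = 0 := by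
  by_contra hu0
  have hF := congr_of_kills_principalCongruence (M := M) hu hKer
  have hNM : N * M ≠ 0 := mul_ne_zero (NeZero.ne N) (NeZero.ne M)
  -- the congruence `a_ℓ ≡ ℓ + 1 (mod p)` off `S' = S ∪ primes(N M) ∪ {p}`
  apply hDDT (S ∪ (N * M).primeFactors ∪ {p}) ?_ hirr
  intro ℓ _ hℓS hgood
  have hℓp : ℓ.Prime := Fact.out
  simp only [Finset.mem_union, Finset.mem_singleton, not_or] at hℓS
  obtain ⟨⟨hℓS, hℓNM⟩, -⟩ := hℓS
  have hℓNM' : ¬ ℓ ∣ N * M := fun h ↦ hℓNM (Nat.mem_primeFactors.mpr ⟨hℓp, h, hNM⟩)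
  have hℓN : ¬ ℓ ∣ N := fun h ↦ hℓNM' (h.mul_right M)
  have hℓM : ¬ ℓ ∣ M := fun h ↦ hℓNM' (h.mul_left N)
  have hcop : IsCoprime (ℓ : ℤ) (M : ℤ) :=
    Nat.isCoprime_iff_coprime.mpr ((Nat.Prime.coprime_iff_not_dvd hℓp).mpr hℓM)
  haveI : NeZero ℓ := ⟨hℓp.ne_zero⟩
  -- shift-invariance at `ℓ`, hence `T_ℓ u = (ℓ + 1) u`
  have hL1 : N * 1 ∣ N * ℓ := by rw [mul_one]; exact Dvd.intro ℓ rfl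
  have hS' := shiftInvariant_of_congruence hu hF hR hcop hL1 (dvd_refl (N * ℓ))
  have hT : heckeU 0 N K hℓp u = ((ℓ : K) + 1) • u :=
    heckeU_eq_smul_of_shiftInvariant hℓp hℓN hL1 (dvd_refl _) (dvd_refl _) hu hS'
  have hTZ : heckeUZ 0 N K hℓp ⟨u, hu⟩ = ((ℓ : K) + 1) • (⟨u, hu⟩ : cocycles 0 N K) := by
    apply Subtype.ext
    rw [coe_heckeUZ, hT]; rfl
  have hne : (⟨u, hu⟩ : cocycles 0 N K) ≠ 0 := fun h ↦ hu0 (congrArg Subtype.val h)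
  have heq : ((W.LFunction ℓ : ℤ) : K) = (ℓ : K) + 1 :=
    eq_of_apply_eq_smul_of_mem_maxGenEigenspace _ hTZ (heig ℓ hℓp hℓS) hne
  -- read the congruence in `ℤ`
  rw [← WeierstrassCurve.LFunction_apply_prime_eq_frobeniusTrace W ℓ hgood]
  have heq' : ((W.LFunction ℓ : ℤ) : K) = (((ℓ : ℤ) + 1 : ℤ) : K) := by rw [heq]; push_cast; rfl
  exact ((CharP.intCast_eq_intCast K p).mp heq').symm.dvd


/-- **The Eisenstein end, with the printed input BY NAME**: `eq_zero_of_killsCongruence_of_isHeckeGenEigenvector` fed with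
the Literature fact `not_irreducible_of_frobeniusTrace_congr_off_finset` (Darmon–Diamond–Taylor Prop. 2.6(b) with a finite
exceptional set; statement-only, `Literature/NumberTheory/EllipticCurves/ModPReducibility.lean`).  So: a degree-`0`
cocycle on `Γ₀(N)` killing `Γ₀(N) ∩ Γ(M)`, lying in `[𝔪_W^∞]` with `W[p]` irreducible (char `p`, torsion condition for
`M`), vanishes — conditional only on that named fact. [folklore] -/
theorem eq_zero_of_killsCongruence_of_isHeckeGenEigenvector_of_fact
    (hDDT : Literature.NumberTheory.EllipticCurves.not_irreducible_of_frobeniusTrace_congr_off_finset)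
    {p : ℕ} [Fact p.Prime] [CharP K p] (W : WeierstrassCurve ℚ) [W.IsElliptic] [W.IsGloballyMinimal]
    (hirr : W.HasIrreducibleModPGaloisRep p) [NeZero N] [NeZero M]
    {u : Gamma0 N → Fin 1 → K} (hu : u ∈ cocycles 0 N K)
    (hKer : ∀ γ : Gamma0 N,
      (∀ i j, ((gmat γ i j : ℤ) : ZMod M) = (((1 : Matrix (Fin 2) (Fin 2) ℤ) i j : ℤ) : ZMod M)) → u γ = 0)
    (hR : ∀ r : K, (M : ℤ) • r = 0 → ∀ x : ℤ, IsCoprime x (M : ℤ) → (x - 1) • r = 0)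
    (S : Finset ℕ) (heig : IsHeckeGenEigenvector S (fun ℓ ↦ ((W.LFunction ℓ : ℤ) : K)) ⟨u, hu⟩) :
    u = 0 :=
  eq_zero_of_killsCongruence_of_isHeckeGenEigenvector W (fun S' h ↦ hDDT W p S' h) hirr hu hKer hR S heig

end End

end Summit.BirchSwinnertonDyer.BirchSwinnertonDyer.Theorems.ManinLocalTwoThree
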